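import Literature.MathematicalPhysics.QuantumLattice.KomaTasakiU1FieldBound
import HarnessLib

/-!
# Koma–Tasaki 1993 Theorem 7.3, ENERGY form: the variational energy of the symmetry-breaking state
# `Ξ^{(k)}` under the field, with the `N`-uniform constant (KT93 (7.4) + (7.24), bounded-overlap densities)

T. Koma, H. Tasaki, Commun. Math. Phys. **158** (1993) 191–214 (`KomaTasaki1993`), §7, proof of
Theorem 7.3, (7.23)–(7.24) (pp. 212–213): the trial state `Ψ_Λ` (7.23) (= KT94's `Ξ^{(k)}`, tree
`U1System.xiState`) is normalised and its energy satisfies (7.24)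
`(Ψ_Λ, H_Λ Ψ_Λ) - E₀ ≤ 2h̄k(ō/σ)^{2k} + O(N⁻¹)` — "the energy difference is smaller than a constant".
Substituted into the variational principle (7.4) `E_Λ(B) ≤ (Ψ_Λ, (H_Λ - B O_Λ) Ψ_Λ)` this is the ENERGY
form of Theorem 7.3 (long-range order forces a kink of slope `≥ (Ψ_Λ, O_Λ Ψ_Λ)/N → √2σ` in the sourced
ground-state energy), the form consumed by tracial / mixed sourced states through the concavity sandwich
`E_Λ(0) - E_Λ(B) ≤ B · ω_B(O_Λ)` (tree `GroundStateSourceBounds`).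

The companion file `KomaTasakiU1FieldBound.lean` PROVES the ORDER form (7.5)/(7.11) for minimisers
(`U1OverlapSystem.field_order_ge_xiState_of_card_ge`, `komaTasakiU1Field_holds`); the energy bound
(7.24) with the `N`-uniform constant `D_k = k·2^{k+1}·h̄·r/μ^k` is used there INSIDE the proof.  This file
exposes it as theorems, over the bounded-overlap systems `U1OverlapSystem` of `KomaTasakiSSBOverlap.lean`:

* `U1OverlapSystem.xiState_energy_le` — every `N`, `k`, given `(O^±)^kΦ ≠ 0`:
  `Re⟨Ξ^{(k)}, H_Λ Ξ^{(k)}⟩ ≤ E + δ_k`,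
  `δ_k = (2k+1)⁻¹ Σ_{n=1}^{k} n(2oN)^{n-1}(4h̄orN)(‖(O^+)ⁿΦ‖⁻¹ + ‖(O^-)ⁿΦ‖⁻¹)` ((7.24) with (7.21)–(7.22));
* `U1OverlapSystem.xiState_energy_le_of_card_ge` — under `k² r′ 2^k ≤ μ^{2k} N`: `‖Ξ^{(k)}‖ = 1` and
  `Re⟨Ξ^{(k)}, H_Λ Ξ^{(k)}⟩ ≤ E + D_k`, `D_k = k 2^{k+1} h̄ r / μ^k`;
* `U1OverlapSystem.field_energy_le_of_card_ge` — (7.4)+(7.24): for every real `B`,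
  `Re⟨Ξ^{(k)}, (H_Λ - B·O^{(1)}_Λ) Ξ^{(k)}⟩ ≤ E + D_k - B · Re⟨Ξ^{(k)}, O^{(1)}_Λ Ξ^{(k)}⟩`, so every
  ground-state energy `E_Λ(B)` of `H_Λ - B O^{(1)}_Λ` is at most this (the right-hand side's last term is
  `≥ B(√2μo - ε)N` for large `N` by `U1OverlapSystem.theorem_2_5_orderOne_fin`).

Direction: LRO ⟹ energy kink / response; the converse is not a theorem
(`Literature.Barriers.HubbardSuperconductivity.SourcedOrderWithoutGroundStateLRO`).

## Mathlib / tree search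

Reused: `U1OverlapSystem.norm_xiState`, `U1System.re_inner_xiState_hamiltonian_le`,
`U1OverlapSystem.norm_comm_hamiltonian_orderPlus_le` / `…Minus…`, `norm_comm_pow_succ_le`,
`U1OverlapSystem.norm_orderPlus_pow_apply_ge` / `…Minus…`, `re_inner_field_apply`
(`KomaTasakiU1FieldBound`); `U1System.norm_orderPlus_le`, `norm_orderMinus_le` (`KomaTasakiSSB*`).
-/

noncomputable section

open Complex Finset Filter
open scoped InnerProductSpace ComplexConjugate Topology

namespace Literature.MathematicalPhysics.QuantumLattice.KomaTasaki

universe u v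

namespace U1OverlapSystem

variable {Λ : Type u} [Fintype Λ] [Nonempty Λ] {E : Type v} [NormedAddCommGroup E]
  [InnerProductSpace ℂ E]
variable (sys : U1OverlapSystem Λ E)

/-- **KT93 (7.24) for a bounded-overlap system, every `N` and `k`.**  For a unit simultaneous eigenvector
`Φ` of `H_Λ` (eigenvalue `E`) and `C_Λ` with obscured symmetry breaking iv) and `(O^±)^kΦ ≠ 0`,
`Re⟨Ξ^{(k)}, H_Λ Ξ^{(k)}⟩ ≤ E + (2k+1)⁻¹ Σ_{n=1}^{k} n(2oN)^{n-1}(4h̄orN)(‖(O^+)ⁿΦ‖⁻¹ + ‖(O^-)ⁿΦ‖⁻¹)`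
((7.24) with the commutator bounds (7.21)–(7.22)). [cite: KomaTasaki1993, Theorem 7.3 proof (7.21)–(7.24)] -/
theorem xiState_energy_le {Φ : E} {EΛ μ : ℝ} (hΦ : sys.IsLROEigenstate Φ EΛ μ)
    {k : ℕ} (hP : (sys.orderPlus ^ k) Φ ≠ 0) (hM : (sys.orderMinus ^ k) Φ ≠ 0) :
    (⟪sys.xiState k Φ, sys.hamiltonian (sys.xiState k Φ)⟫_ℂ).re ≤
      EΛ + (2 * (k : ℝ) + 1)⁻¹ * ∑ j ∈ range k,
            (((j : ℝ) + 1) * (2 * sys.obar * Fintype.card Λ) ^ j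
                * (4 * sys.hbar * sys.obar * sys.r * Fintype.card Λ))
              * ((‖(sys.orderPlus ^ (j + 1)) Φ‖)⁻¹ + (‖(sys.orderMinus ^ (j + 1)) Φ‖)⁻¹) := by
  -- unfold the abbreviations `sys.orderPlus = sys.collapse.orderPlus` etc.
  dsimp only [U1OverlapSystem.orderPlus, U1OverlapSystem.orderMinus, U1OverlapSystem.xiState]
    at hP hM ⊢
  obtain ⟨c, hc⟩ := hΦ.eigen_C
  -- (7.24): the energy of `Ξ^{(k)}`
  have hE := sys.collapse.re_inner_xiState_hamiltonian_le k hΦ.norm_eq_one hc hΦ.eigen_hamiltonian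
    hP hM
  rw [collapse_hamiltonian] at hE
  -- (7.21)–(7.22): each commutator term
  have hOp : ‖sys.collapse.orderPlus‖ ≤ 2 * sys.obar * Fintype.card Λ := by
    have h := sys.collapse.norm_orderPlus_le
    rw [collapse_obar, Fintype.card_unit, Nat.cast_one, mul_one] at h
    simpa [mul_assoc] using h
  have hOm : ‖sys.collapse.orderMinus‖ ≤ 2 * sys.obar * Fintype.card Λ := by
    have h := sys.collapse.norm_orderMinus_le
    rw [collapse_obar, Fintype.card_unit, Nat.cast_one, mul_one] at h
    simpa [mul_assoc] using h
  have hκp : ‖sys.hamiltonian * sys.collapse.orderPlus - sys.collapse.orderPlus * sys.hamiltonian‖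
      ≤ 4 * sys.hbar * sys.obar * sys.r * Fintype.card Λ := sys.norm_comm_hamiltonian_orderPlus_le
  have hκm : ‖sys.hamiltonian * sys.collapse.orderMinus - sys.collapse.orderMinus * sys.hamiltonian‖
      ≤ 4 * sys.hbar * sys.obar * sys.r * Fintype.card Λ := sys.norm_comm_hamiltonian_orderMinus_le
  have hterm : ∀ j ∈ range k,
      ‖sys.hamiltonian * sys.collapse.orderPlus ^ (j + 1)
              - sys.collapse.orderPlus ^ (j + 1) * sys.hamiltonian‖
            / ‖(sys.collapse.orderPlus ^ (j + 1)) Φ‖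
          + ‖sys.hamiltonian * sys.collapse.orderMinus ^ (j + 1)
              - sys.collapse.orderMinus ^ (j + 1) * sys.hamiltonian‖
            / ‖(sys.collapse.orderMinus ^ (j + 1)) Φ‖
        ≤ (((j : ℝ) + 1) * (2 * sys.obar * Fintype.card Λ) ^ j
              * (4 * sys.hbar * sys.obar * sys.r * Fintype.card Λ))
            * ((‖(sys.collapse.orderPlus ^ (j + 1)) Φ‖)⁻¹
              + (‖(sys.collapse.orderMinus ^ (j + 1)) Φ‖)⁻¹) := by
    intro j _
    have h1 := norm_comm_pow_succ_le sys.hamiltonian sys.collapse.orderPlus hOp hκp j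
    have h2 := norm_comm_pow_succ_le sys.hamiltonian sys.collapse.orderMinus hOm hκm j
    rw [mul_add, div_eq_mul_inv, div_eq_mul_inv]
    gcongr
  have hsum := Finset.sum_le_sum hterm
  have hinv : 0 ≤ (2 * (k : ℝ) + 1)⁻¹ := inv_nonneg.mpr (by positivity)
  have hmul := mul_le_mul_of_nonneg_left hsum hinv
  linarith

/-- **KT93 (7.24) with the `N`-uniform constant** ("the energy difference is smaller than a constant"):
under the size condition `k² r′ 2^k ≤ μ^{2k} N` the symmetry-breaking state is normalised,
`‖Ξ^{(k)}‖ = 1`, and `Re⟨Ξ^{(k)}, H_Λ Ξ^{(k)}⟩ ≤ E + D_k`, `D_k = k·2^{k+1}·h̄·r/μ^k`.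
[cite: KomaTasaki1993, Theorem 7.3 proof (7.23)–(7.24)] -/
theorem xiState_energy_le_of_card_ge [FiniteDimensional ℂ E] {Φ : E} {EΛ μ : ℝ}
    (hΦ : sys.IsLROEigenstate Φ EΛ μ)
    {k : ℕ} (hk : 1 ≤ k) (hN : (k : ℝ) ^ 2 * sys.r' * 2 ^ k ≤ μ ^ (2 * k) * Fintype.card Λ) :
    ‖sys.xiState k Φ‖ = 1 ∧
      (⟪sys.xiState k Φ, sys.hamiltonian (sys.xiState k Φ)⟫_ℂ).re ≤
        EΛ + (k : ℝ) * 2 ^ (k + 1) * sys.hbar * sys.r / μ ^ k := by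
  have hμ : 0 < μ := hΦ.mu_pos
  have hμ1 : μ ≤ 1 := hΦ.mu_le_one
  have ho : 0 < sys.obar := sys.obar_pos
  have hh : 0 ≤ sys.hbar := sys.hbar_nonneg
  have hN0 : (0 : ℝ) < Fintype.card Λ := Nat.cast_pos.mpr Fintype.card_pos
  -- the size condition at every `n = m + 1 ≤ k`
  have hsize : ∀ m : ℕ, m + 1 ≤ k →
      ((m : ℝ) + 1) ^ 2 * sys.r' * 2 ^ (m + 1) ≤ μ ^ (2 * (m + 1)) * Fintype.card Λ := by
    intro m hm
    have h1' : (m : ℝ) + 1 ≤ k := by exact_mod_cast hm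
    have h1 : ((m : ℝ) + 1) ^ 2 ≤ (k : ℝ) ^ 2 := pow_le_pow_left₀ (by positivity) h1' 2
    have h2 : (2 : ℝ) ^ (m + 1) ≤ 2 ^ k := pow_le_pow_right₀ (by norm_num) hm
    have h3 : μ ^ (2 * k) ≤ μ ^ (2 * (m + 1)) := pow_le_pow_of_le_one hμ.le hμ1 (by omega)
    have hr' : (0 : ℝ) ≤ sys.r' := Nat.cast_nonneg _
    calc ((m : ℝ) + 1) ^ 2 * sys.r' * 2 ^ (m + 1) ≤ (k : ℝ) ^ 2 * sys.r' * 2 ^ k := by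
          gcongr
      _ ≤ μ ^ (2 * k) * Fintype.card Λ := hN
      _ ≤ μ ^ (2 * (m + 1)) * Fintype.card Λ := mul_le_mul_of_nonneg_right h3 hN0.le
  have hPm : ∀ m : ℕ, m + 1 ≤ k →
      (μ * sys.obar * Fintype.card Λ) ^ (m + 1) ≤ ‖(sys.orderPlus ^ (m + 1)) Φ‖ :=
    fun m hm => sys.norm_orderPlus_pow_apply_ge hΦ m (hsize m hm)
  have hMm : ∀ m : ℕ, m + 1 ≤ k →
      (μ * sys.obar * Fintype.card Λ) ^ (m + 1) ≤ ‖(sys.orderMinus ^ (m + 1)) Φ‖ :=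
    fun m hm => sys.norm_orderMinus_pow_apply_ge hΦ m (hsize m hm)
  have hs : 0 < μ * sys.obar * Fintype.card Λ := by positivity
  -- `(O^±)^k Φ ≠ 0`
  obtain ⟨k', rfl⟩ : ∃ k', k = k' + 1 := ⟨k - 1, by omega⟩
  have hP : (sys.orderPlus ^ (k' + 1)) Φ ≠ 0 := by
    intro h0
    have := hPm k' le_rfl
    rw [h0, norm_zero] at this
    exact absurd this (not_le.mpr (pow_pos hs _))
  have hM : (sys.orderMinus ^ (k' + 1)) Φ ≠ 0 := by
    intro h0
    have := hMm k' le_rfl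
    rw [h0, norm_zero] at this
    exact absurd this (not_le.mpr (pow_pos hs _))
  obtain ⟨c, hc⟩ := hΦ.eigen_C
  have hnorm : ‖sys.xiState (k' + 1) Φ‖ = 1 := sys.norm_xiState (k' + 1) hΦ.norm_eq_one hc hP hM
  have henergy := sys.xiState_energy_le hΦ hP hM
  -- bound `δ_k ≤ D_k`: every summand is at most `Y = k 2^{k+2} h̄ r / μ^k`
  set Y : ℝ := ((k' : ℝ) + 1) * 2 ^ (k' + 1 + 2) * sys.hbar * sys.r / μ ^ (k' + 1) with hYdef
  have hY0 : 0 ≤ Y := by positivity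
  have hterm : ∀ j ∈ range (k' + 1),
      (((j : ℝ) + 1) * (2 * sys.obar * Fintype.card Λ) ^ j
            * (4 * sys.hbar * sys.obar * sys.r * Fintype.card Λ))
          * ((‖(sys.orderPlus ^ (j + 1)) Φ‖)⁻¹ + (‖(sys.orderMinus ^ (j + 1)) Φ‖)⁻¹) ≤ Y := by
    intro j hj
    have hjk : j + 1 ≤ k' + 1 := by rw [Finset.mem_range] at hj; omega
    have hA : 0 ≤ ((j : ℝ) + 1) * (2 * sys.obar * Fintype.card Λ) ^ j
        * (4 * sys.hbar * sys.obar * sys.r * Fintype.card Λ) := by positivity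
    have hi1 : (‖(sys.orderPlus ^ (j + 1)) Φ‖)⁻¹ ≤ ((μ * sys.obar * Fintype.card Λ) ^ (j + 1))⁻¹ :=
      inv_anti₀ (pow_pos hs _) (hPm j hjk)
    have hi2 : (‖(sys.orderMinus ^ (j + 1)) Φ‖)⁻¹ ≤ ((μ * sys.obar * Fintype.card Λ) ^ (j + 1))⁻¹ :=
      inv_anti₀ (pow_pos hs _) (hMm j hjk)
    have step1 : (((j : ℝ) + 1) * (2 * sys.obar * Fintype.card Λ) ^ j
              * (4 * sys.hbar * sys.obar * sys.r * Fintype.card Λ))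
            * ((‖(sys.orderPlus ^ (j + 1)) Φ‖)⁻¹ + (‖(sys.orderMinus ^ (j + 1)) Φ‖)⁻¹)
        ≤ (((j : ℝ) + 1) * (2 * sys.obar * Fintype.card Λ) ^ j
              * (4 * sys.hbar * sys.obar * sys.r * Fintype.card Λ))
            * (2 * ((μ * sys.obar * Fintype.card Λ) ^ (j + 1))⁻¹) :=
      mul_le_mul_of_nonneg_left (by linarith) hA
    have e : (((j : ℝ) + 1) * (2 * sys.obar * Fintype.card Λ) ^ j
              * (4 * sys.hbar * sys.obar * sys.r * Fintype.card Λ))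
            * (2 * ((μ * sys.obar * Fintype.card Λ) ^ (j + 1))⁻¹)
        = ((j : ℝ) + 1) * 2 ^ (j + 3) * sys.hbar * sys.r / μ ^ (j + 1) := by
      field_simp
      ring
    have step2 : ((j : ℝ) + 1) * 2 ^ (j + 3) * sys.hbar * sys.r / μ ^ (j + 1) ≤ Y := by
      rw [hYdef, div_le_div_iff₀ (pow_pos hμ _) (pow_pos hμ _)]
      have h1 : (j : ℝ) + 1 ≤ (k' : ℝ) + 1 := by exact_mod_cast hjk
      have h2 : (2 : ℝ) ^ (j + 3) ≤ 2 ^ (k' + 1 + 2) := pow_le_pow_right₀ (by norm_num) (by omega)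
      have h3 : μ ^ (k' + 1) ≤ μ ^ (j + 1) := pow_le_pow_of_le_one hμ.le hμ1 hjk
      have hhr : 0 ≤ sys.hbar * sys.r := by positivity
      calc ((j : ℝ) + 1) * 2 ^ (j + 3) * sys.hbar * sys.r * μ ^ (k' + 1)
          = (((j : ℝ) + 1) * 2 ^ (j + 3)) * (sys.hbar * sys.r) * μ ^ (k' + 1) := by ring
        _ ≤ (((k' : ℝ) + 1) * 2 ^ (k' + 1 + 2)) * (sys.hbar * sys.r) * μ ^ (j + 1) := by
            gcongr
        _ = ((k' : ℝ) + 1) * 2 ^ (k' + 1 + 2) * sys.hbar * sys.r * μ ^ (j + 1) := by ring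
    linarith [step1, step2, e.le, e.ge]
  have hsum : ∑ j ∈ range (k' + 1),
      (((j : ℝ) + 1) * (2 * sys.obar * Fintype.card Λ) ^ j
            * (4 * sys.hbar * sys.obar * sys.r * Fintype.card Λ))
          * ((‖(sys.orderPlus ^ (j + 1)) Φ‖)⁻¹ + (‖(sys.orderMinus ^ (j + 1)) Φ‖)⁻¹)
        ≤ ((k' : ℝ) + 1) * Y := by
    have h := Finset.sum_le_sum hterm
    rw [Finset.sum_const, Finset.card_range, nsmul_eq_mul, Nat.cast_add_one] at h
    exact h
  -- `(2k+1)⁻¹ (k Y) ≤ Y/2 = D_k`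
  have hk0 : (0 : ℝ) < 2 * ((k' + 1 : ℕ) : ℝ) + 1 := by positivity
  have hδ : (2 * ((k' + 1 : ℕ) : ℝ) + 1)⁻¹ * ∑ j ∈ range (k' + 1),
      (((j : ℝ) + 1) * (2 * sys.obar * Fintype.card Λ) ^ j
            * (4 * sys.hbar * sys.obar * sys.r * Fintype.card Λ))
          * ((‖(sys.orderPlus ^ (j + 1)) Φ‖)⁻¹ + (‖(sys.orderMinus ^ (j + 1)) Φ‖)⁻¹)
        ≤ ((k' + 1 : ℕ) : ℝ) * 2 ^ (k' + 1 + 1) * sys.hbar * sys.r / μ ^ (k' + 1) := by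
    have h1 : (2 * ((k' + 1 : ℕ) : ℝ) + 1)⁻¹ * (((k' : ℝ) + 1) * Y) ≤ Y / 2 := by
      rw [inv_mul_le_iff₀ hk0]
      push_cast
      nlinarith
    have h2 : Y / 2 = ((k' + 1 : ℕ) : ℝ) * 2 ^ (k' + 1 + 1) * sys.hbar * sys.r / μ ^ (k' + 1) := by
      rw [hYdef]
      push_cast
      field_simp
      ring
    calc _ ≤ (2 * ((k' + 1 : ℕ) : ℝ) + 1)⁻¹ * (((k' : ℝ) + 1) * Y) :=
          mul_le_mul_of_nonneg_left hsum (inv_nonneg.mpr hk0.le)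
      _ ≤ Y / 2 := h1
      _ = _ := h2
  exact ⟨hnorm, by linarith [henergy, hδ]⟩


/-- **KT93 Theorem 7.3, ENERGY form ((7.4) with (7.24)).**  Under the size condition, for every real
field `B` the unit vector `Ξ^{(k)}` has
`Re⟨Ξ^{(k)}, (H_Λ - B·O^{(1)}_Λ) Ξ^{(k)}⟩ ≤ E + D_k - B · Re⟨Ξ^{(k)}, O^{(1)}_Λ Ξ^{(k)}⟩`,
hence every ground-state energy `E_Λ(B)` of `H_Λ - B O^{(1)}_Λ` obeys the same bound: long-range order
forces the sourced ground-state energy to drop with slope at least `Re⟨Ξ^{(k)},O^{(1)}Ξ^{(k)}⟩`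
(`≥ (√2μo - ε)N` eventually, `U1OverlapSystem.theorem_2_5_orderOne_fin`), up to the `N`-uniform tower
cost `D_k = k 2^{k+1} h̄ r μ^{-k}`. [cite: KomaTasaki1993, Theorem 7.3, proof (7.4), (7.23)–(7.24)] -/
theorem field_energy_le_of_card_ge [FiniteDimensional ℂ E] {Φ : E} {EΛ μ : ℝ}
    (hΦ : sys.IsLROEigenstate Φ EΛ μ)
    {k : ℕ} (hk : 1 ≤ k) (hN : (k : ℝ) ^ 2 * sys.r' * 2 ^ k ≤ μ ^ (2 * k) * Fintype.card Λ)
    (B : ℝ) :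
    ‖sys.xiState k Φ‖ = 1 ∧
      (⟪sys.xiState k Φ, (sys.hamiltonian - (B : ℂ) • sys.order 0) (sys.xiState k Φ)⟫_ℂ).re ≤
        EΛ + (k : ℝ) * 2 ^ (k + 1) * sys.hbar * sys.r / μ ^ k
          - B * (⟪sys.xiState k Φ, sys.order 0 (sys.xiState k Φ)⟫_ℂ).re := by
  obtain ⟨hnorm, henergy⟩ := sys.xiState_energy_le_of_card_ge hΦ hk hN
  refine ⟨hnorm, ?_⟩
  rw [re_inner_field_apply]
  linarith

end U1OverlapSystem

end Literature.MathematicalPhysics.QuantumLattice.KomaTasaki
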